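import Summits.BirchSwinnertonDyer.BirchSwinnertonDyer.Theorems.InertBadSignedBranchesInertBadAtThreePointwiseKatoLever
import Summits.BirchSwinnertonDyer.BirchSwinnertonDyer.Theorems.InertBadSignedBranchesInertBadAtThreeManinOfKatoThree
import HarnessLib

/-!
# Line `bed_at_three`'s Manin input at `3` from the CM-INERT INSTANCES of F-es-18 (v6 stub of crux `InertBadAtThree`)

Summit `BirchSwinnertonDyer`, crux `InertBadAtThree` (stmt-BirchSwinnertonDyer-19225; K8 `InertBadSignedBranches` r4 / BED r5), line
of record `Lines/bed_at_three.lean` (lead `bsd-line-ibd-p1` g6), companion of `…InertBadAtThreePointwiseKatoLever` (the POINTWISE Kato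
shift lever `not_three_dvd_c_of_neronIntegralAt`). Skeleton v6 replaces the registered stub `stub_katoFactThreePolar` (= the named
Literature statement F-es-18 `kato_neron_isIntegral_twistedSymbolSum_of_additive_three_polar`, quantified over EVERY additive-at-3
curve with irreducible `W[3]`) by `stub_neronIntegralThreeCMInert` = F-es-18's body on the CM-INERT BAD-3 CLASS ONLY (globally minimal
CM curves with `3` inert in the CM field and bad at `3`), spelled INLINE below as the hypothesis `hC` (no definition is introduced;
crux idea card `Cruxes/InertBadAtThree/Ideas/rubin-e1-inert-three.md`, bsd-idea-18 g6, whose CM-side road — Eisenstein–Kronecker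
numbers of `ℚ(i)` etc. — targets exactly these instances). This file proves:

* **`not_three_dvd_c_of_neronIntegralCMInert`** — `3 ∤ c` at a lattice-optimal conductor-level datum of such a curve, from `hC`;
* **`maninAtThree_of_neronIntegralCMInert`** — the line's `ManinAtThree` (body VERBATIM = p620851's
  `maninAtThree_of_katoFactThreePolar`) from `hC`;
* **`maninAtThreeQuartic_of_neronIntegralCMInert`** — the v3 quartic-cell statement (body VERBATIM) from `hC`;
* **`neronIntegralCMInert_of_katoFact`** — F-es-18 ⟹ `hC` (restriction): one `_holds` of F-es-18 still closes the v6 stub, so the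
  debt stays shared with route ManinLocalTwoThree's crux 22968.

HONEST FRAMING: nothing here proves F-es-18, any instance of it, Manin's conjecture, the crux, or BSD; the v6 stub is OPEN (two roads:
Kato's (P1)–(P5) reading restricted to the class, or the card's CM-side road). No definitions; axioms standard.
-/

set_option autoImplicit false
set_option linter.dupNamespace false

noncomputable section

open scoped Classical MatrixGroups ModularForm

open CongruenceSubgroup WeierstrassCurve
  Literature.NumberTheory.EllipticCurves Literature.NumberTheory.EllipticCurves.ModularForms
  Literature.NumberTheory.EllipticCurves.Rank1Residual

namespace Summit.BirchSwinnertonDyer.BirchSwinnertonDyer.Theorems.InertBadSignedBranchesInertBadAtThreeManinOfNeronIntegralCMInert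

open Summit.BirchSwinnertonDyer.Rank1Residual
open Summit.BirchSwinnertonDyer.BirchSwinnertonDyer.Theorems.InertBadSignedBranchesInertBadAtThreeManinOfKatoThree
  (nine_dvd_conductorNorm_of_hasCM_of_not_good)
open Summit.BirchSwinnertonDyer.BirchSwinnertonDyer.Theorems.InertBadSignedBranchesInertBadAtThreePointwiseKatoLever
  (not_three_dvd_c_of_neronIntegralAt)

/-- **`3 ∤ c(D)` for a CM curve with CM-inert bad `3`, from the F-es-18 instances at that curve** (conductor-level datum with
the lattice clause): `9 ∣ N_W` (`nine_dvd_conductorNorm_of_hasCM_of_not_good`) and `W[3]` irreducible (`X12.irr_of_cmInert`,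
Mazur 1978) feed the pointwise lever. [cite: Kato2004Asterisque, Thm. 9.7 (p. 189)] [cite: Mazur1978, Prop. 6.3 (1)] -/
theorem not_three_dvd_c_of_neronIntegralCMInert
    (hC : ∀ (V : WeierstrassCurve ℚ) [V.IsElliptic] [V.IsGloballyMinimal],
      V.HasCM → CMInert V 3 → ¬ Good V 3 →
      ∀ {N : ℕ} [NeZero N]
        (f : CuspForm (Gamma0 N) 2) (_ : IsNewformOf V f)
        (_ : ¬ V.HasGoodReductionAtPrime 3) (_ : ¬ V.HasMultiplicativeReductionAtPrime 3)
        (_ : V.HasIrreducibleModPGaloisRep 3) (m : ℕ) [NeZero m] (_ : m.Coprime (3 * N))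
        (χ : DirichletCharacter ℂ m) (_ : χ.IsPrimitive) (_ : χ ≠ 1) (_ : ¬ 3 ∣ orderOf χ)
        (_ : χ (3 : ZMod m) ≠ 1) (_ : χ (3 : ZMod m) ≠ -1) (ϖ : ℚ) (r : ℂ),
        (χ.Even → (ϖ : ℝ) * V.realPeriodRat = plusPeriod f →
          (∏ ℓ ∈ N.primeFactors with ¬ ℓ ^ 2 ∣ N,
              (((ℓ : ℂ) - (V.LFunction ℓ : ℂ) * χ (ℓ : ZMod m)) *
                ((ℓ : ℂ) - (V.LFunction ℓ : ℂ) * (χ (ℓ : ZMod m))⁻¹))) *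
              twistedSymbolSum f χ = r * (plusPeriod f : ℂ) →
          ∃ s : ℕ, ¬ 3 ∣ s ∧ IsIntegral ℤ ((s : ℂ) * ϖ * r)) ∧
        (χ.Odd → (ϖ : ℝ) * V.imaginaryPeriodRat = minusPeriod f →
          (∏ ℓ ∈ N.primeFactors with ¬ ℓ ^ 2 ∣ N,
              (((ℓ : ℂ) - (V.LFunction ℓ : ℂ) * χ (ℓ : ZMod m)) *
                ((ℓ : ℂ) - (V.LFunction ℓ : ℂ) * (χ (ℓ : ZMod m))⁻¹))) *
              twistedSymbolSum f χ = r * (minusPeriod f : ℂ) * Complex.I →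
          ∃ s : ℕ, ¬ 3 ∣ s ∧ IsIntegral ℤ ((s : ℂ) * ϖ * r)))
    (W : WeierstrassCurve ℚ) [W.IsElliptic] [W.IsGloballyMinimal] [NeZero (W.conductorNorm ℤ)]
    (D : ModularParametrizationData W (W.conductorNorm ℤ))
    (hopt : ∀ z ∈ D.L.lattice, ∃ w ∈ periodLattice D.f, z = D.c * w)
    (hCM : W.HasCM) (hin : CMInert W 3) (hbad : ¬ Good W 3) : ¬ (3 : ℤ) ∣ D.c :=
  not_three_dvd_c_of_neronIntegralAt D (hC W hCM hin hbad) hopt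
    (nine_dvd_conductorNorm_of_hasCM_of_not_good W hCM hbad) (X12.irr_of_cmInert W 3 (by norm_num) hin)

/-- **Line `bed_at_three`'s `ManinAtThree` (body VERBATIM = `maninAtThree_of_katoFactThreePolar`, p620851) from the CM-inert
instances of F-es-18 only** — every Kodaira cell at `3`, no Kodaira split, no Mazur / Abbes–Ullmo / Česnavičius / modularity input.
[cite: Kato2004Asterisque, Thm. 9.7 (p. 189)] [cite: Mazur1978, Prop. 6.3 (1)] -/
theorem maninAtThree_of_neronIntegralCMInert
    (hC : ∀ (V : WeierstrassCurve ℚ) [V.IsElliptic] [V.IsGloballyMinimal],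
      V.HasCM → CMInert V 3 → ¬ Good V 3 →
      ∀ {N : ℕ} [NeZero N]
        (f : CuspForm (Gamma0 N) 2) (_ : IsNewformOf V f)
        (_ : ¬ V.HasGoodReductionAtPrime 3) (_ : ¬ V.HasMultiplicativeReductionAtPrime 3)
        (_ : V.HasIrreducibleModPGaloisRep 3) (m : ℕ) [NeZero m] (_ : m.Coprime (3 * N))
        (χ : DirichletCharacter ℂ m) (_ : χ.IsPrimitive) (_ : χ ≠ 1) (_ : ¬ 3 ∣ orderOf χ)
        (_ : χ (3 : ZMod m) ≠ 1) (_ : χ (3 : ZMod m) ≠ -1) (ϖ : ℚ) (r : ℂ),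
        (χ.Even → (ϖ : ℝ) * V.realPeriodRat = plusPeriod f →
          (∏ ℓ ∈ N.primeFactors with ¬ ℓ ^ 2 ∣ N,
              (((ℓ : ℂ) - (V.LFunction ℓ : ℂ) * χ (ℓ : ZMod m)) *
                ((ℓ : ℂ) - (V.LFunction ℓ : ℂ) * (χ (ℓ : ZMod m))⁻¹))) *
              twistedSymbolSum f χ = r * (plusPeriod f : ℂ) →
          ∃ s : ℕ, ¬ 3 ∣ s ∧ IsIntegral ℤ ((s : ℂ) * ϖ * r)) ∧
        (χ.Odd → (ϖ : ℝ) * V.imaginaryPeriodRat = minusPeriod f →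
          (∏ ℓ ∈ N.primeFactors with ¬ ℓ ^ 2 ∣ N,
              (((ℓ : ℂ) - (V.LFunction ℓ : ℂ) * χ (ℓ : ZMod m)) *
                ((ℓ : ℂ) - (V.LFunction ℓ : ℂ) * (χ (ℓ : ZMod m))⁻¹))) *
              twistedSymbolSum f χ = r * (minusPeriod f : ℂ) * Complex.I →
          ∃ s : ℕ, ¬ 3 ∣ s ∧ IsIntegral ℤ ((s : ℂ) * ϖ * r))) :
    ∀ (W : WeierstrassCurve ℚ) [W.IsElliptic] [W.IsGloballyMinimal] [NeZero (W.conductorNorm ℤ)]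
      (p : ℕ) [Fact p.Prime]
      (D : Literature.NumberTheory.EllipticCurves.ModularForms.ModularParametrizationData W
        (W.conductorNorm ℤ)),
      W.HasCM → W.analyticRank = 1 → p = 3 →
      Literature.NumberTheory.EllipticCurves.Rank1Residual.CMInert W p →
      ¬ Literature.NumberTheory.EllipticCurves.Rank1Residual.Good W p →
      (∀ z ∈ D.L.lattice, ∃ w ∈ Literature.NumberTheory.EllipticCurves.ModularForms.periodLattice D.f,
        z = D.c * w) → ¬ (p : ℤ) ∣ D.c := by
  intro W _ _ _ p _ D hCM _ h3 hin hbad hopt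
  subst h3
  exact not_three_dvd_c_of_neronIntegralCMInert hC W D hopt hCM hin hbad

/-- **The v3 stub statement `ManinAtThreeQuartic` (body VERBATIM = `maninAtThreeQuartic_of_katoFactThreePolar`, p620851) from the
CM-inert instances of F-es-18 only.** [cite: Kato2004Asterisque, Thm. 9.7 (p. 189)] [cite: Mazur1978, Prop. 6.3 (1)] -/
theorem maninAtThreeQuartic_of_neronIntegralCMInert
    (hC : ∀ (V : WeierstrassCurve ℚ) [V.IsElliptic] [V.IsGloballyMinimal],
      V.HasCM → CMInert V 3 → ¬ Good V 3 →
      ∀ {N : ℕ} [NeZero N]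
        (f : CuspForm (Gamma0 N) 2) (_ : IsNewformOf V f)
        (_ : ¬ V.HasGoodReductionAtPrime 3) (_ : ¬ V.HasMultiplicativeReductionAtPrime 3)
        (_ : V.HasIrreducibleModPGaloisRep 3) (m : ℕ) [NeZero m] (_ : m.Coprime (3 * N))
        (χ : DirichletCharacter ℂ m) (_ : χ.IsPrimitive) (_ : χ ≠ 1) (_ : ¬ 3 ∣ orderOf χ)
        (_ : χ (3 : ZMod m) ≠ 1) (_ : χ (3 : ZMod m) ≠ -1) (ϖ : ℚ) (r : ℂ),
        (χ.Even → (ϖ : ℝ) * V.realPeriodRat = plusPeriod f →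
          (∏ ℓ ∈ N.primeFactors with ¬ ℓ ^ 2 ∣ N,
              (((ℓ : ℂ) - (V.LFunction ℓ : ℂ) * χ (ℓ : ZMod m)) *
                ((ℓ : ℂ) - (V.LFunction ℓ : ℂ) * (χ (ℓ : ZMod m))⁻¹))) *
              twistedSymbolSum f χ = r * (plusPeriod f : ℂ) →
          ∃ s : ℕ, ¬ 3 ∣ s ∧ IsIntegral ℤ ((s : ℂ) * ϖ * r)) ∧
        (χ.Odd → (ϖ : ℝ) * V.imaginaryPeriodRat = minusPeriod f →
          (∏ ℓ ∈ N.primeFactors with ¬ ℓ ^ 2 ∣ N,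
              (((ℓ : ℂ) - (V.LFunction ℓ : ℂ) * χ (ℓ : ZMod m)) *
                ((ℓ : ℂ) - (V.LFunction ℓ : ℂ) * (χ (ℓ : ZMod m))⁻¹))) *
              twistedSymbolSum f χ = r * (minusPeriod f : ℂ) * Complex.I →
          ∃ s : ℕ, ¬ 3 ∣ s ∧ IsIntegral ℤ ((s : ℂ) * ϖ * r))) :
    ∀ (W : WeierstrassCurve ℚ) [W.IsElliptic] [W.IsGloballyMinimal] [NeZero (W.conductorNorm ℤ)] (p : ℕ)
      [Fact p.Prime] (D : Literature.NumberTheory.EllipticCurves.ModularForms.ModularParametrizationData W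
        (W.conductorNorm ℤ)) (v : IsDedekindDomain.HeightOneSpectrum ℤ),
      Rat.HeightOneSpectrum.natGenerator v = p → W.HasCM → W.analyticRank = 1 → p = 3 →
      Literature.NumberTheory.EllipticCurves.Rank1Residual.CMInert W p →
      ¬ Literature.NumberTheory.EllipticCurves.Rank1Residual.Good W p →
      (∀ z ∈ D.L.lattice, ∃ w ∈ Literature.NumberTheory.EllipticCurves.ModularForms.periodLattice D.f,
        z = D.c * w) →
      (W.j = 1728 ∧ (W.kodairaSymbolAt v = Literature.NumberTheory.DiophantineGeometry.KodairaSymbol.III ∨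
        W.kodairaSymbolAt v = Literature.NumberTheory.DiophantineGeometry.KodairaSymbol.IIIstar)) →
      ¬ (p : ℤ) ∣ D.c := by
  intro W _ _ _ p _ D v _ hCM hr h3 hin hbad hopt _
  exact maninAtThree_of_neronIntegralCMInert hC W p D hCM hr h3 hin hbad hopt

/-- **F-es-18 ⟹ its CM-inert instances** (restriction; so a `_holds` of the named Literature statement still closes the line's
v6 stub by this one-liner, and the debt stays shared with route ManinLocalTwoThree's crux 22968).
[cite: Kato2004Asterisque, Thm. 9.7 (p. 189)] -/
theorem neronIntegralCMInert_of_katoFact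
    (hK : kato_neron_isIntegral_twistedSymbolSum_of_additive_three_polar) :
    ∀ (V : WeierstrassCurve ℚ) [V.IsElliptic] [V.IsGloballyMinimal],
      V.HasCM → CMInert V 3 → ¬ Good V 3 →
      ∀ {N : ℕ} [NeZero N]
        (f : CuspForm (Gamma0 N) 2) (_ : IsNewformOf V f)
        (_ : ¬ V.HasGoodReductionAtPrime 3) (_ : ¬ V.HasMultiplicativeReductionAtPrime 3)
        (_ : V.HasIrreducibleModPGaloisRep 3) (m : ℕ) [NeZero m] (_ : m.Coprime (3 * N))
        (χ : DirichletCharacter ℂ m) (_ : χ.IsPrimitive) (_ : χ ≠ 1) (_ : ¬ 3 ∣ orderOf χ)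
        (_ : χ (3 : ZMod m) ≠ 1) (_ : χ (3 : ZMod m) ≠ -1) (ϖ : ℚ) (r : ℂ),
        (χ.Even → (ϖ : ℝ) * V.realPeriodRat = plusPeriod f →
          (∏ ℓ ∈ N.primeFactors with ¬ ℓ ^ 2 ∣ N,
              (((ℓ : ℂ) - (V.LFunction ℓ : ℂ) * χ (ℓ : ZMod m)) *
                ((ℓ : ℂ) - (V.LFunction ℓ : ℂ) * (χ (ℓ : ZMod m))⁻¹))) *
              twistedSymbolSum f χ = r * (plusPeriod f : ℂ) →
          ∃ s : ℕ, ¬ 3 ∣ s ∧ IsIntegral ℤ ((s : ℂ) * ϖ * r)) ∧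
        (χ.Odd → (ϖ : ℝ) * V.imaginaryPeriodRat = minusPeriod f →
          (∏ ℓ ∈ N.primeFactors with ¬ ℓ ^ 2 ∣ N,
              (((ℓ : ℂ) - (V.LFunction ℓ : ℂ) * χ (ℓ : ZMod m)) *
                ((ℓ : ℂ) - (V.LFunction ℓ : ℂ) * (χ (ℓ : ZMod m))⁻¹))) *
              twistedSymbolSum f χ = r * (minusPeriod f : ℂ) * Complex.I →
          ∃ s : ℕ, ¬ 3 ∣ s ∧ IsIntegral ℤ ((s : ℂ) * ϖ * r)) :=
  fun V _ _ _ _ _ ↦ hK V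

end Summit.BirchSwinnertonDyer.BirchSwinnertonDyer.Theorems.InertBadSignedBranchesInertBadAtThreeManinOfNeronIntegralCMInert

end
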